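import Summits.QuantumAdvantage.QuantumAdvantage.Theorems.MobiusLadderLiouvilleOrthogonalTC0SizeRung
import Summits.QuantumAdvantage.QuantumAdvantage.Theorems.MobiusLadderLiouvilleOrthogonalTC0SpectralLevel
import HarnessLib

/-!
# Crux `MobiusLadder.LiouvilleOrthogonalTC0` (stmt-QuantumAdvantage-1393): the logarithmic-size rung —
`λ` is orthogonal to every threshold circuit with `≤ δ log₃ n` gates (any depth, unbounded fan-in),
unconditionally

Line `Sketch` (lead `prover-line-stmt-QuantumAdvantage-1393-c2-0`). The bounded-size rung
(`…SizeRung.lean`: a circuit over `tcBasis` with `K` gates has Fourier tail `≤ 3^{K+1}/√m` above every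
level `m ≥ 1`) balanced against the level `⌊n^{1/R}⌋₊ + 1` of the single-level spectral criterion
(`…SpectralLevel.lean`, `R = ⌈3/c⌉₊` for Bourgain's exponent `c`): with `3^K ≤ n^δ`, `δ = 1/(8R)`,
the tail at that level is `≤ 3 n^{δ - 1/(2R)} = 3 n^{-3/(8R)} → 0`.

* `liouville_orthogonal_size_log` — there is `δ > 0` such that for every `ε > 0`, eventually in `n`,
  every circuit `C` over `tcBasis` on `n` digits with `3^{size C} ≤ n^δ` (i.e. `size C ≤ δ log₃ n`)
  has `|Σ_{N<2ⁿ} λ(N) sgn C(bits N)| ≤ ε 2ⁿ`.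

(`δ` depends only on the exponent in Bourgain's uniform Möbius–Walsh bound; with the printed `c = 1/10`
one gets `R = 30`, `δ = 1/240`.)
-/

set_option linter.dupNamespace false -- D-0017: single-problem summit ⇒ `QuantumAdvantage.QuantumAdvantage` by design

noncomputable section

namespace Summit.QuantumAdvantage.QuantumAdvantage.Theorems.LiouvilleOrthogonalTC0

open Filter Finset Topology
open Literature.Computability.Complexity
open Literature.Computability.Complexity.LowDegree (tailWeight)
open Literature.Probability.RandomGraphs.LowDegree (sgn)
open Literature.NumberTheory.Sieve

/-- **`λ` is orthogonal to every threshold circuit of logarithmic size** (unconditional): there is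
`δ > 0` such that for every `ε > 0`, for all sufficiently large `n`, every circuit `C` on the `n`
binary digits over `tcBasis` (`∧ₖ`, `∨ₖ`, `¬`, `MAJₖ` of any fan-in, any depth) with
`3^{size C} ≤ n^δ` satisfies `|Σ_{N<2ⁿ} λ(N) · sgn (C(bits N))| ≤ ε · 2ⁿ`. -/
theorem liouville_orthogonal_size_log : ∃ δ : ℝ, 0 < δ ∧ ∀ ε : ℝ, 0 < ε → ∀ᶠ n : ℕ in atTop,
    ∀ C : Circuit (Fin n), C.IsOver tcBasis → (3 : ℝ) ^ C.size ≤ (n : ℝ) ^ δ →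
      |∑ N ∈ Finset.range (2 ^ n), ((ArithmeticFunction.liouville N : ℤ) : ℝ) *
          sgn (C.eval (fun i : Fin n => Nat.testBit N i))| ≤ ε * (2 : ℝ) ^ n := by
  obtain ⟨c, hc, hB⟩ := bourgain_liouville_walsh_holds
  -- parameters
  set R : ℕ := ⌈(3 : ℝ) / c⌉₊ with hRdef
  have hR1 : 1 ≤ R := by
    have : (0 : ℝ) < 3 / c := by positivity
    exact Nat.one_le_iff_ne_zero.mpr (Nat.pos_iff_ne_zero.mp (Nat.ceil_pos.mpr this))
  have hRc : 3 ≤ (R : ℝ) * c := by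
    have h1 : (3 : ℝ) / c ≤ R := Nat.le_ceil _
    have := mul_le_mul_of_nonneg_right h1 hc.le
    rwa [div_mul_cancel₀ _ hc.ne'] at this
  have hRpos : (0 : ℝ) < R := by exact_mod_cast (show 0 < R by omega)
  refine ⟨1 / (8 * R), by positivity, fun ε hε => ?_⟩
  have hε3 : 0 < (ε / 3) ^ 2 := by positivity
  -- `3 n^{-3/(8R)} ≤ (ε/3)²` eventually
  have hdec : Tendsto (fun n : ℕ => 3 * (n : ℝ) ^ (-(3 / (8 * (R : ℝ))))) atTop (𝓝 0) := by
    have h := (tendsto_rpow_neg_atTop (show (0 : ℝ) < 3 / (8 * R) by positivity)).comp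
      tendsto_natCast_atTop_atTop
    simpa using h.const_mul (3 : ℝ)
  filter_upwards [liouville_orthogonal_of_tailWeight_level hc hB hR1 hRc ε hε,
    hdec.eventually_le_const hε3, eventually_ge_atTop 1] with n hn hsmall hn1 C hBC hsz
  refine hn (fun y => C.eval y) ?_
  -- the tail of `C` at level `k + 1`, `k = ⌊n^{1/R}⌋₊`
  set k : ℕ := ⌊((n : ℝ)) ^ ((1 : ℝ) / R)⌋₊ with hkdef
  have hnpos : (0 : ℝ) < n := by exact_mod_cast hn1
  have htail := tailWeight_circuit_size_le C.size C hBC le_rfl (m := k + 1) (by omega)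
  refine htail.trans (le_trans ?_ hsmall)
  -- `3^{K+1}/√(k+1) ≤ 3 n^δ / n^{1/(2R)} = 3 n^{-3/(8R)}`
  have hk1 : (n : ℝ) ^ ((1 : ℝ) / R) < (k : ℝ) + 1 := Nat.lt_floor_add_one _
  have hsqrt : (n : ℝ) ^ ((1 : ℝ) / (2 * R)) ≤ Real.sqrt ((k : ℝ) + 1) := by
    have h1 : Real.sqrt ((n : ℝ) ^ ((1 : ℝ) / R)) ≤ Real.sqrt ((k : ℝ) + 1) :=
      Real.sqrt_le_sqrt hk1.le
    have h2 : Real.sqrt ((n : ℝ) ^ ((1 : ℝ) / R)) = (n : ℝ) ^ ((1 : ℝ) / (2 * R)) := by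
      rw [Real.sqrt_eq_rpow, ← Real.rpow_mul hnpos.le]
      congr 1
      field_simp
    rw [← h2]; exact h1
  have hspos : 0 < Real.sqrt ((k : ℝ) + 1) := Real.sqrt_pos.2 (by positivity)
  have hnum : (3 : ℝ) ^ (C.size + 1) ≤ 3 * (n : ℝ) ^ ((1 : ℝ) / (8 * R)) := by
    rw [pow_succ, mul_comm]
    exact mul_le_mul_of_nonneg_left hsz (by norm_num)
  have hcast : ((k + 1 : ℕ) : ℝ) = (k : ℝ) + 1 := by push_cast; ring
  rw [hcast]
  calc (3 : ℝ) ^ (C.size + 1) / Real.sqrt ((k : ℝ) + 1)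
      ≤ 3 * (n : ℝ) ^ ((1 : ℝ) / (8 * R)) / (n : ℝ) ^ ((1 : ℝ) / (2 * R)) := by
        gcongr
  _ = 3 * (n : ℝ) ^ (-(3 / (8 * (R : ℝ)))) := by
        rw [mul_div_assoc, ← Real.rpow_sub hnpos]
        congr 2
        field_simp
        ring

/-- **The same rung in logarithmic form**: there is `δ > 0` such that for every `ε > 0`, eventually
in `n`, every circuit over `tcBasis` on `n` digits with at most `δ · log n` gates (any depth, any
fan-in) has `|Σ_{N<2ⁿ} λ(N) · sgn (C(bits N))| ≤ ε · 2ⁿ`. -/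
theorem liouville_orthogonal_size_logarithmic : ∃ δ : ℝ, 0 < δ ∧ ∀ ε : ℝ, 0 < ε →
    ∀ᶠ n : ℕ in atTop, ∀ C : Circuit (Fin n), C.IsOver tcBasis → (C.size : ℝ) ≤ δ * Real.log n →
      |∑ N ∈ Finset.range (2 ^ n), ((ArithmeticFunction.liouville N : ℤ) : ℝ) *
          sgn (C.eval (fun i : Fin n => Nat.testBit N i))| ≤ ε * (2 : ℝ) ^ n := by
  obtain ⟨δ, hδ, h⟩ := liouville_orthogonal_size_log
  have hlog3 : 0 < Real.log 3 := Real.log_pos (by norm_num)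
  refine ⟨δ / Real.log 3, by positivity, fun ε hε => ?_⟩
  filter_upwards [h ε hε, eventually_ge_atTop 1] with n hn hn1 C hB hsz
  refine hn C hB ?_
  have hnpos : (0 : ℝ) < n := by exact_mod_cast hn1
  have h3 : (3 : ℝ) ^ C.size = Real.exp (Real.log 3 * C.size) := by
    rw [← Real.rpow_natCast, Real.rpow_def_of_pos (by norm_num : (0 : ℝ) < 3)]
  have hnδ : (n : ℝ) ^ δ = Real.exp (Real.log n * δ) := Real.rpow_def_of_pos hnpos δ
  rw [h3, hnδ, Real.exp_le_exp]
  have := mul_le_mul_of_nonneg_left hsz hlog3.le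
  calc Real.log 3 * C.size ≤ Real.log 3 * (δ / Real.log 3 * Real.log n) := this
    _ = Real.log n * δ := by
        rw [mul_comm, mul_right_comm, div_mul_cancel₀ _ hlog3.ne', mul_comm]

/-- **Registered stub `stub_sizeLog`**: verbatim `liouville_orthogonal_size_log`. -/
theorem stub_sizeLog : ∃ δ : ℝ, 0 < δ ∧ ∀ ε : ℝ, 0 < ε → ∀ᶠ n : ℕ in atTop, ∀ C : Circuit (Fin n), C.IsOver tcBasis → (3 : ℝ) ^ C.size ≤ (n : ℝ) ^ δ → |∑ N ∈ Finset.range (2 ^ n), ((ArithmeticFunction.liouville N : ℤ) : ℝ) * sgn (C.eval (fun i : Fin n => Nat.testBit N i))| ≤ ε * (2 : ℝ) ^ n :=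
  liouville_orthogonal_size_log

end Summit.QuantumAdvantage.QuantumAdvantage.Theorems.LiouvilleOrthogonalTC0
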